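import Mathlib
import Literature.NumberTheory.DiophantineGeometry.BelyiLemmaProofs

/-!
# Noncritical Belyi maps on `ℙ¹`, step I: descent to `ℚ` protecting a `p`-adically large point

S. Mochizuki, *Noncritical Belyi maps*, Math. J. Okayama Univ. **46** (2004) 105–113
[cite: MochizukiNCBelyi2004], Lemma 2.4 ("Reduction to the Rational Case", pp. 4–5; cf.
Scherr–Zieve, *Separated Belyi maps*, MRL **21** (2014), Prop. 7): for a finite `S ⊂ ℚ̄` and a
point `β ∉ S` there is `g : ℙ¹ → ℙ¹` over `ℚ` with `g(S)` and all critical values of `g`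
RATIONAL, and `g(β)` rational, NOT a critical value, NOT in `g(S)`.  The printed proofs compose
Belyi's degree-lowering polynomials (Bombieri–Gubler Lemma 12.2.7, formalised in
`BelyiLemmaProofs.lean` as `BelyiAlgorithm.step1`) and keep `β` away from the other points by an
ARCHIMEDEAN magnitude argument ("`|β| ≥ C` … `|α| ≤ 1` … all of the coefficients of `f₀(x)` have
absolute value `≤ d₀^{d₀}`", [NCBelyi] p. 5).

This file proves the statement by a `p`-ADIC variant of that argument, with no coefficient
estimates: run the Bombieri–Gubler recursion with `P = d₀^{d₀}·f₀` (`f₀ ∈ ℤ[x]` the monic minimal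
polynomial of an algebraic INTEGER `α₀` of top degree `d₀`); then (a) algebraic integrality of the
point set is preserved (`P(s)` is integral; a root `r` of `f₀'` has `d₀·r` integral, so
`d₀^{d₀} f₀(r)` is integral — `Polynomial.scaleRoots`), and (b) for a prime `p > d₀` and a rational
`b` with `|b|_p > 1`: `|P(b)|_p = |b|_p^{d₀} > 1` and `P'(b) ≠ 0` (leading terms dominate
`p`-adically since `p ∤ d₀`).  Main result `NoncriticalBelyi.descent`: for a finite set `S` of
algebraic integers of degrees `< p` there is a non-constant `g ∈ ℤ[x]` with `g(S) ⊂ ℤ`, all critical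
values of `g` in `ℤ`, and, for every rational `b` with `|b|_p > 1`, `|g(b)|_p > 1` (so
`g(b) ∉ ℤ ⊇ g(S) ∪ {critical values}`) and `g'(b) ≠ 0` — the input of the rational step
(Scherr–Zieve Prop. 8) of the noncritical Belyi map on `ℙ¹_ℚ` ([NCBelyi] Thm. 2.5, genus `0`) used
by [GenEll] Thm. 2.1.  No definitions, no named facts.
-/

namespace Literature.NumberTheory.DiophantineGeometry

open Polynomial

namespace NoncriticalBelyi

/-! ### Integrality bookkeeping -/

/-- If `x` is integral over `ℤ` then so is `Q(x)` for `Q ∈ ℤ[x]`. [folklore] -/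
private theorem isIntegral_aeval_int {x : ℂ} (hx : IsIntegral ℤ x) (Q : ℤ[X]) :
    IsIntegral ℤ (aeval x Q) :=
  .of_mem_of_fg _ hx.fg_adjoin_singleton _ (aeval_mem_adjoin_singleton _ _)

/-- A rational number that is an algebraic integer (inside `ℂ`) is a rational integer. [folklore] -/
private theorem exists_int_of_isIntegral_rat {r : ℚ} (hr : IsIntegral ℤ (algebraMap ℚ ℂ r)) :
    ∃ z : ℤ, (z : ℚ) = r := by
  have h1 : IsIntegral ℤ r := (isIntegral_algebraMap_iff (algebraMap ℚ ℂ).injective).1 hr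
  obtain ⟨z, hz⟩ := IsIntegrallyClosed.isIntegral_iff.1 h1
  exact ⟨z, by simpa using hz⟩

/-- An algebraic integer of degree `≤ 1` over `ℚ` is a rational integer. [folklore] -/
private theorem exists_int_of_natDegree_le_one {x : ℂ} (hx : IsIntegral ℤ x)
    (h : (minpoly ℚ x).natDegree ≤ 1) : ∃ z : ℤ, x = (z : ℂ) := by
  obtain ⟨r, hr⟩ := BelyiAlgorithm.exists_rat_of_natDegree_minpoly_le_one hx.tower_top h
  obtain ⟨z, hz⟩ := exists_int_of_isIntegral_rat (r := r) (hr ▸ hx)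
  exact ⟨z, by rw [hr, ← hz]; simp⟩

/-- For an algebraic integer `α`, the rational minimal polynomial is the image of the integral one;
in particular they have the same degree. [folklore] -/
private theorem natDegree_minpoly_int {α : ℂ} (hα : IsIntegral ℤ α) :
    (minpoly ℤ α).natDegree = (minpoly ℚ α).natDegree := by
  rw [minpoly.isIntegrallyClosed_eq_field_fractions' ℚ hα, natDegree_map_eq_of_injective
    (algebraMap ℤ ℚ).injective_int]

/-- `d^d · f(r)` is integral when `f ∈ ℤ[x]` has degree `d` and `d·r` is integral
(`d^d f(r) = (scaleRoots f d)(d r)`). [folklore] -/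
private theorem isIntegral_pow_mul_aeval {r : ℂ} (f : ℤ[X]) {d : ℕ} (hd : f.natDegree = d)
    (hr : IsIntegral ℤ ((d : ℂ) * r)) :
    IsIntegral ℤ ((d : ℂ) ^ d * aeval r f) := by
  have h := scaleRoots_eval₂_mul (p := f) (algebraMap ℤ ℂ) r (d : ℤ)
  have h2 : aeval ((d : ℂ) * r) (scaleRoots f (d : ℤ)) = (d : ℂ) ^ d * aeval r f := by
    rw [aeval_def, aeval_def]; simpa [hd] using h
  rw [← h2]; exact isIntegral_aeval_int hr _

/-! ### `p`-adic size of polynomial values at `p`-adically large rationals -/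

section Padic

variable {p : ℕ} [Fact p.Prime]

/-- `|q^n|_p = |q|_p^n`. [folklore] -/
private theorem padicNorm_pow (q : ℚ) (n : ℕ) : padicNorm p (q ^ n) = padicNorm p q ^ n := by
  induction n with
  | zero => simp
  | succ n ih => rw [pow_succ, padicNorm.mul, ih, pow_succ]

/-- If `f ∈ ℤ[x]` has degree `n ≥ 1`, `p ∤` its leading coefficient, and `|b|_p > 1`, then
`|f(b)|_p = |b|_p^n`: the leading term dominates `p`-adically (the `p`-adic substitute for the
archimedean estimate of [NCBelyi] Lem. 2.4). [folklore] -/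
private theorem padicNorm_aeval_eq {f : ℤ[X]} {n : ℕ} (hn : f.natDegree = n)
    (hlead : ¬ (p : ℤ) ∣ f.leadingCoeff) {b : ℚ} (hb : 1 < padicNorm p b) :
    padicNorm p (aeval b f) = padicNorm p b ^ n := by
  have hb0 : 0 < padicNorm p b := lt_trans zero_lt_one hb
  -- split off the leading term
  have hsum : aeval b f = (f.leadingCoeff : ℚ) * b ^ n +
      ∑ i ∈ Finset.range n, (f.coeff i : ℚ) * b ^ i := by
    rw [aeval_eq_sum_range, hn, Finset.sum_range_succ, add_comm]
    simp [leadingCoeff, hn, Algebra.smul_def]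
  have hT : padicNorm p ((f.leadingCoeff : ℚ) * b ^ n) = padicNorm p b ^ n := by
    rw [padicNorm.mul, (padicNorm.int_eq_one_iff _).2 hlead, one_mul, padicNorm_pow]
  have hR : padicNorm p (∑ i ∈ Finset.range n, (f.coeff i : ℚ) * b ^ i) < padicNorm p b ^ n := by
    apply padicNorm.sum_lt' _ (pow_pos hb0 n)
    intro i hi
    rw [Finset.mem_range] at hi; rw [padicNorm.mul, padicNorm_pow]
    calc padicNorm p (f.coeff i : ℚ) * padicNorm p b ^ i ≤ 1 * padicNorm p b ^ i :=
          mul_le_mul_of_nonneg_right (padicNorm.of_int _) (pow_nonneg hb0.le i)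
      _ = padicNorm p b ^ i := one_mul _
      _ < padicNorm p b ^ n := pow_lt_pow_right₀ hb hi
  rw [hsum, padicNorm.add_eq_max_of_ne (by rw [hT]; exact hR.ne'), hT, max_eq_left hR.le]

/-- Under the hypotheses of `padicNorm_aeval_eq`: `|f(b)|_p > 1`, in particular `f(b) ≠ 0`.
[folklore] -/
private theorem one_lt_padicNorm_aeval {f : ℤ[X]} {n : ℕ} (hn : f.natDegree = n) (hn0 : 0 < n)
    (hlead : ¬ (p : ℤ) ∣ f.leadingCoeff) {b : ℚ} (hb : 1 < padicNorm p b) :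
    1 < padicNorm p (aeval b f) := by
  rw [padicNorm_aeval_eq hn hlead hb]
  exact one_lt_pow₀ hb hn0.ne'

end Padic

/-! ### The reduction step -/

variable {p : ℕ}

/-- Base case: all points are rational integers, `g = x`. [folklore] -/
private theorem goal_base (S : Finset ℂ) (hint : ∀ s ∈ S, IsIntegral ℤ s)
    (hdeg : ∀ s ∈ S, (minpoly ℚ s).natDegree ≤ 1) :
    (0 < (X : ℤ[X]).natDegree ∧ (∀ s ∈ S, ∃ r : ℤ, aeval s (X : ℤ[X]) = (r : ℂ)) ∧
      (∀ z : ℂ, aeval z (derivative (X : ℤ[X])) = 0 → ∃ r : ℤ, aeval z (X : ℤ[X]) = (r : ℂ)) ∧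
      ∀ b : ℚ, 1 < padicNorm p b →
        1 < padicNorm p (aeval b (X : ℤ[X])) ∧ aeval b (derivative (X : ℤ[X])) ≠ 0) := by
  refine ⟨by simp, ?_, ?_, ?_⟩
  · intro s hs
    obtain ⟨z, hz⟩ := exists_int_of_natDegree_le_one (hint s hs) (hdeg s hs)
    exact ⟨z, by simp [hz]⟩
  · intro z hz; simp at hz
  · intro b hb; simpa using hb

/-- Composition bookkeeping (chain rule): if `P` maps `S` and its own critical points into `S'`,
sends `p`-adically large rationals to `p`-adically large rationals without being critical there,
and `g'` solves the goal for `S'`, then `g' ∘ P` solves it for `S`.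
[cite: MochizukiNCBelyi2004, Lem 2.4 (proof, p. 5)] -/
theorem goal_comp {S S' : Finset ℂ} {P g' : ℤ[X]} (hP : 0 < P.natDegree)
    (hS : ∀ s ∈ S, aeval s P ∈ S')
    (hcrit : ∀ z : ℂ, aeval z (derivative P) = 0 → aeval z P ∈ S')
    (hb : ∀ b : ℚ, 1 < padicNorm p b → 1 < padicNorm p (aeval b P) ∧ aeval b (derivative P) ≠ 0)
    (hg' : (0 < g'.natDegree ∧ (∀ s ∈ S', ∃ r : ℤ, aeval s g' = (r : ℂ)) ∧
      (∀ z : ℂ, aeval z (derivative g') = 0 → ∃ r : ℤ, aeval z g' = (r : ℂ)) ∧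
      ∀ b : ℚ, 1 < padicNorm p b → 1 < padicNorm p (aeval b g') ∧ aeval b (derivative g') ≠ 0)) :
    (0 < (g'.comp P).natDegree ∧ (∀ s ∈ S, ∃ r : ℤ, aeval s (g'.comp P) = (r : ℂ)) ∧
      (∀ z : ℂ, aeval z (derivative (g'.comp P)) = 0 → ∃ r : ℤ, aeval z (g'.comp P) = (r : ℂ)) ∧
      ∀ b : ℚ, 1 < padicNorm p b →
        1 < padicNorm p (aeval b (g'.comp P)) ∧ aeval b (derivative (g'.comp P)) ≠ 0) := by
  obtain ⟨hg'deg, hg'S, hg'crit, hg'b⟩ := hg'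
  refine ⟨?_, ?_, ?_, ?_⟩
  · rw [natDegree_comp]; exact Nat.mul_pos hg'deg hP
  · intro s hs; rw [aeval_comp]; exact hg'S _ (hS s hs)
  · intro z hz
    rw [derivative_comp, map_mul, mul_eq_zero] at hz
    rw [aeval_comp]
    rcases hz with hz | hz
    · exact hg'S _ (hcrit z hz)
    · rw [aeval_comp] at hz; exact hg'crit _ hz
  · intro b hbb
    obtain ⟨h1, h2⟩ := hb b hbb
    obtain ⟨h3, h4⟩ := hg'b _ h1
    refine ⟨by rw [aeval_comp]; exact h3, ?_⟩
    rw [derivative_comp, map_mul, aeval_comp]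
    exact mul_ne_zero h2 h4

variable [Fact p.Prime]

/-- The reduction step ([NCBelyi] Lem. 2.4, "nested induction" on `m(S), d(S)`; Bombieri–Gubler
p. 405): for `α ∈ S` of top degree `d + 1 ≥ 2` and `P = (d+1)^{d+1} · f₀`, `f₀ ∈ ℤ[x]` the minimal
polynomial of `α`, the set `S' = P(S ∪ {roots of f₀'})` consists of algebraic integers of degree
`≤ d + 1`, has fewer points of degree `d + 1`, receives `P(S)` and the critical values of `P`; and
for
a prime `p > d + 1`, `P` keeps `p`-adically large rationals large and is not critical at them.
[cite: MochizukiNCBelyi2004, Lem 2.4 (proof, pp. 4–5)] -/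
theorem reduce {d : ℕ} (hd : 1 ≤ d) (hpd : d + 1 < p) (S : Finset ℂ)
    (hint : ∀ s ∈ S, IsIntegral ℤ s) (hdeg : ∀ s ∈ S, (minpoly ℚ s).natDegree ≤ d + 1)
    {α : ℂ} (hαS : α ∈ S) (hα : (minpoly ℚ α).natDegree = d + 1) :
    ∃ (S' : Finset ℂ) (P : ℤ[X]), 0 < P.natDegree ∧
      (∀ t ∈ S', IsIntegral ℤ t) ∧ (∀ t ∈ S', (minpoly ℚ t).natDegree ≤ d + 1) ∧
      (S'.filter fun t => (minpoly ℚ t).natDegree = d + 1).card <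
        (S.filter fun s => (minpoly ℚ s).natDegree = d + 1).card ∧
      (∀ s ∈ S, aeval s P ∈ S') ∧
      (∀ z : ℂ, aeval z (derivative P) = 0 → aeval z P ∈ S') ∧
      ∀ b : ℚ, 1 < padicNorm p b → 1 < padicNorm p (aeval b P) ∧ aeval b (derivative P) ≠ 0 := by
  classical
  have hαint : IsIntegral ℤ α := hint α hαS
  set f₀ : ℤ[X] := minpoly ℤ α with hf₀
  have hf₀monic : f₀.Monic := minpoly.monic hαint
  have hf₀deg : f₀.natDegree = d + 1 := by rw [hf₀, natDegree_minpoly_int hαint, hα]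
  have hf₀Q : minpoly ℚ α = f₀.map (algebraMap ℤ ℚ) :=
    minpoly.isIntegrallyClosed_eq_field_fractions' ℚ hαint
  -- the derivative: degree `d`, leading coefficient `d + 1`
  have hf₀' : (derivative f₀).natDegree = d := by
    rw [natDegree_derivative, hf₀deg]; rfl
  have hf₀'lead : (derivative f₀).leadingCoeff = (d + 1 : ℕ) := by
    rw [leadingCoeff, hf₀', coeff_derivative, ← hf₀deg]
    have : f₀.coeff f₀.natDegree = 1 := hf₀monic
    rw [hf₀deg] at this ⊢
    rw [this, one_mul]
    push_cast; ring
  have hf₀'ne : derivative f₀ ≠ 0 := by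
    intro h; rw [h, natDegree_zero] at hf₀'; omega
  have hmap : (derivative f₀).map (algebraMap ℤ ℂ) ≠ 0 :=
    (Polynomial.map_ne_zero_iff (algebraMap ℤ ℂ).injective_int).2 hf₀'ne
  -- `D = (d+1)^(d+1)` and `P = D · f₀`
  set D : ℤ := ((d + 1 : ℕ) : ℤ) ^ (d + 1) with hD
  have hD0 : D ≠ 0 := pow_ne_zero _ (by exact_mod_cast Nat.succ_ne_zero d)
  set P : ℤ[X] := C D * f₀ with hPdef
  have hPdeg : P.natDegree = d + 1 := by rw [hPdef, natDegree_C_mul hD0, hf₀deg]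
  have hPaeval : ∀ u : ℂ, aeval u P = (D : ℂ) * aeval u f₀ := by
    intro u; rw [hPdef, map_mul, aeval_C]; rfl
  have hPaevalQ : ∀ b : ℚ, aeval b P = (D : ℚ) * aeval b f₀ := by
    intro b; rw [hPdef, map_mul, aeval_C]; rfl
  have hP' : derivative P = C D * derivative f₀ := by
    rw [hPdef, derivative_mul, derivative_C, zero_mul, zero_add]
  -- the critical points `S₁` (roots of `f₀'`)
  set S₁ : Finset ℂ := ((derivative f₀).map (algebraMap ℤ ℂ)).roots.toFinset with hS₁
  have hS₁mem : ∀ u : ℂ, u ∈ S₁ ↔ aeval u (derivative f₀) = 0 := by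
    intro u
    rw [hS₁, Multiset.mem_toFinset, mem_roots hmap, IsRoot.def, eval_map_algebraMap]
  -- roots of `f₀'`: `(d+1)·u` is integral, degree `≤ d`
  have hS₁int : ∀ u ∈ S₁, IsIntegral ℤ (((d + 1 : ℕ) : ℂ) * u) ∧
      (minpoly ℚ u).natDegree ≤ d := by
    intro u hu
    have hu' := (hS₁mem u).1 hu
    constructor
    · have h := isIntegral_leadingCoeff_smul (R := ℤ) (p := derivative f₀) (x := u) hu'
      rw [hf₀'lead, Algebra.smul_def, map_natCast] at h
      exact h
    · -- `u` is a root of `f₀' ∈ ℚ[x]` of degree `d`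
      have huQ : aeval u ((derivative f₀).map (algebraMap ℤ ℚ)) = 0 := by
        rw [aeval_map_algebraMap]; exact hu'
      have hne : (derivative f₀).map (algebraMap ℤ ℚ) ≠ 0 :=
        (Polynomial.map_ne_zero_iff (algebraMap ℤ ℚ).injective_int).2 hf₀'ne
      have := BelyiAlgorithm.isIntegral_of_aeval_eq_zero hne huQ
      rw [natDegree_map_eq_of_injective (algebraMap ℤ ℚ).injective_int, hf₀'] at this
      exact this.2
  have hS₁intQ : ∀ u ∈ S₁, IsIntegral ℚ u := by
    intro u hu
    have hne : (derivative f₀).map (algebraMap ℤ ℚ) ≠ 0 :=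
      (Polynomial.map_ne_zero_iff (algebraMap ℤ ℚ).injective_int).2 hf₀'ne
    have huQ : aeval u ((derivative f₀).map (algebraMap ℤ ℚ)) = 0 := by
      rw [aeval_map_algebraMap]; exact (hS₁mem u).1 hu
    exact (BelyiAlgorithm.isIntegral_of_aeval_eq_zero hne huQ).1
  -- the new set
  set F : ℂ → ℂ := fun u => aeval u P with hF
  refine ⟨(S ∪ S₁).image F, P, by rw [hPdeg]; omega, ?_, ?_, ?_, ?_, ?_, ?_⟩
  · -- integrality of `S'`
    intro t ht
    obtain ⟨u, hu, rfl⟩ := Finset.mem_image.1 ht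
    rw [hF]; dsimp only; rw [hPaeval]
    rcases Finset.mem_union.1 hu with hu | hu
    · exact (isIntegral_algebraMap (x := D)).mul (isIntegral_aeval_int (hint u hu) f₀)
    · have h := isIntegral_pow_mul_aeval f₀ hf₀deg (hS₁int u hu).1
      have hDc : (D : ℂ) = ((d + 1 : ℕ) : ℂ) ^ (d + 1) := by rw [hD]; push_cast; rfl
      rw [hDc]; exact h
  · -- degrees `≤ d + 1`
    intro t ht
    obtain ⟨u, hu, rfl⟩ := Finset.mem_image.1 ht
    have hPu : F u = aeval u (P.map (algebraMap ℤ ℚ)) := by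
      rw [hF]; exact (aeval_map_algebraMap ℚ u P).symm
    rw [hPu]
    rcases Finset.mem_union.1 hu with hu | hu
    · exact (BelyiAlgorithm.natDegree_minpoly_aeval_le (hint u hu).tower_top _).trans (hdeg u hu)
    · exact (BelyiAlgorithm.natDegree_minpoly_aeval_le (hS₁intQ u hu) _).trans
        ((hS₁int u hu).2.trans (Nat.le_succ d))
  · -- fewer points of top degree
    have hsub : ((S ∪ S₁).filter fun u => (minpoly ℚ (F u)).natDegree = d + 1) ⊆
        (S.filter fun s => (minpoly ℚ s).natDegree = d + 1).erase α := by
      intro u hu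
      rw [Finset.mem_filter] at hu
      obtain ⟨hu, hfu⟩ := hu
      have hPu : F u = aeval u (P.map (algebraMap ℤ ℚ)) := by
        rw [hF]; exact (aeval_map_algebraMap ℚ u P).symm
      rw [Finset.mem_erase, Finset.mem_filter]
      rcases Finset.mem_union.1 hu with huS | huS₁
      · have h1 : (minpoly ℚ (F u)).natDegree ≤ (minpoly ℚ u).natDegree := by
          rw [hPu]; exact BelyiAlgorithm.natDegree_minpoly_aeval_le (hint u huS).tower_top _
        refine ⟨?_, huS, le_antisymm (hdeg u huS) (hfu ▸ h1)⟩
        rintro rfl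
        have h0 : F u = 0 := by
          rw [hF]; dsimp only; rw [hPaeval]
          have : aeval u f₀ = 0 := by rw [hf₀]; exact minpoly.aeval ℤ u
          rw [this, mul_zero]
        rw [h0, minpoly.zero, natDegree_X] at hfu
        omega
      · exfalso
        have h1 : (minpoly ℚ (F u)).natDegree ≤ (minpoly ℚ u).natDegree := by
          rw [hPu]; exact BelyiAlgorithm.natDegree_minpoly_aeval_le (hS₁intQ u huS₁) _
        have h2 := (hS₁int u huS₁).2
        omega
    calc (((S ∪ S₁).image F).filter fun t => (minpoly ℚ t).natDegree = d + 1).card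
        = (((S ∪ S₁).filter fun u => (minpoly ℚ (F u)).natDegree = d + 1).image F).card := by
          rw [Finset.filter_image]
      _ ≤ ((S ∪ S₁).filter fun u => (minpoly ℚ (F u)).natDegree = d + 1).card :=
          Finset.card_image_le
      _ ≤ ((S.filter fun s => (minpoly ℚ s).natDegree = d + 1).erase α).card :=
          Finset.card_le_card hsub
      _ < (S.filter fun s => (minpoly ℚ s).natDegree = d + 1).card :=
          Finset.card_erase_lt_of_mem (Finset.mem_filter.2 ⟨hαS, hα⟩)
  · intro s hs
    exact Finset.mem_image.2 ⟨s, Finset.mem_union.2 (Or.inl hs), rfl⟩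
  · intro z hz
    rw [hP', map_mul, aeval_C, mul_eq_zero] at hz
    rcases hz with hz | hz
    · exact absurd hz ((map_ne_zero_iff _ (algebraMap ℤ ℂ).injective_int).2 hD0)
    · exact Finset.mem_image.2 ⟨z, Finset.mem_union.2 (Or.inr ((hS₁mem z).2 hz)), rfl⟩
  · -- the protected point
    intro b hb
    have hp : (p : ℤ) ∣ ((d + 1 : ℕ) : ℤ) → False := by
      intro h
      have := Int.le_of_dvd (by exact_mod_cast Nat.succ_pos d) h
      omega
    have hpD : ¬ (p : ℤ) ∣ D := by
      rw [hD]; intro h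
      exact hp (Int.Prime.dvd_pow' (Fact.out : p.Prime) h)
    have hDnorm : padicNorm p (D : ℚ) = 1 := (padicNorm.int_eq_one_iff _).2 hpD
    have hleadf : ¬ (p : ℤ) ∣ f₀.leadingCoeff := by
      rw [show f₀.leadingCoeff = 1 from hf₀monic]; exact fun h => hp (dvd_trans h (one_dvd _))
    have hleadf' : ¬ (p : ℤ) ∣ (derivative f₀).leadingCoeff := by rw [hf₀'lead]; exact hp
    constructor
    · rw [hPaevalQ, padicNorm.mul, hDnorm, one_mul]
      exact one_lt_padicNorm_aeval hf₀deg (Nat.succ_pos d) hleadf hb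
    · rw [hP', map_mul, aeval_C]
      refine mul_ne_zero ((map_ne_zero_iff _ (algebraMap ℤ ℚ).injective_int).2 hD0) ?_
      intro h
      have h1 := one_lt_padicNorm_aeval hf₀' hd hleadf' hb
      rw [h, padicNorm.zero] at h1
      exact absurd h1 (by norm_num)

/-- Fixed top degree `d + 1 ≥ 2`: induction on the number of points of degree `d + 1`.
[cite: MochizukiNCBelyi2004, Lem 2.4 (proof, p. 5)] -/
theorem goal_succ {d : ℕ} (hd : 1 ≤ d) (hpd : d + 1 < p)
    (ih : ∀ S : Finset ℂ, (∀ s ∈ S, IsIntegral ℤ s) → (∀ s ∈ S, (minpoly ℚ s).natDegree ≤ d) →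
      ∃ g : ℤ[X], (0 < g.natDegree ∧ (∀ s ∈ S, ∃ r : ℤ, aeval s g = (r : ℂ)) ∧
      (∀ z : ℂ, aeval z (derivative g) = 0 → ∃ r : ℤ, aeval z g = (r : ℂ)) ∧
      ∀ b : ℚ, 1 < padicNorm p b →
        1 < padicNorm p (aeval b g) ∧ aeval b (derivative g) ≠ 0)) (N : ℕ) :
    ∀ S : Finset ℂ, (S.filter fun s => (minpoly ℚ s).natDegree = d + 1).card = N →
      (∀ s ∈ S, IsIntegral ℤ s) → (∀ s ∈ S, (minpoly ℚ s).natDegree ≤ d + 1) →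
      ∃ g : ℤ[X], (0 < g.natDegree ∧ (∀ s ∈ S, ∃ r : ℤ, aeval s g = (r : ℂ)) ∧
      (∀ z : ℂ, aeval z (derivative g) = 0 → ∃ r : ℤ, aeval z g = (r : ℂ)) ∧
      ∀ b : ℚ, 1 < padicNorm p b → 1 < padicNorm p (aeval b g) ∧ aeval b (derivative g) ≠ 0) := by
  induction N using Nat.strong_induction_on with
  | _ N ihN =>
    intro S hN hint hdeg
    by_cases h0 : (S.filter fun s => (minpoly ℚ s).natDegree = d + 1) = ∅
    · refine ih S hint fun s hs => ?_
      have h1 := hdeg s hs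
      have h2 : ¬ (minpoly ℚ s).natDegree = d + 1 := fun h =>
        (Finset.eq_empty_iff_forall_notMem.1 h0) s (Finset.mem_filter.2 ⟨hs, h⟩)
      omega
    · obtain ⟨α, hα⟩ := Finset.nonempty_iff_ne_empty.2 h0
      rw [Finset.mem_filter] at hα
      obtain ⟨S', P, hPdeg, hint', hdeg', hlt, hS, hcrit, hb⟩ :=
        reduce hd hpd S hint hdeg hα.1 hα.2
      obtain ⟨g', hg'⟩ := ihN _ (hN ▸ hlt) S' rfl hint' hdeg'
      exact ⟨g'.comp P, goal_comp hPdeg hS hcrit hb hg'⟩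

/-- Induction on the top degree `d < p`. [cite: MochizukiNCBelyi2004, Lem 2.4 (proof, p. 5)] -/
theorem goal_all (d : ℕ) (hdp : d < p) : ∀ S : Finset ℂ, (∀ s ∈ S, IsIntegral ℤ s) →
    (∀ s ∈ S, (minpoly ℚ s).natDegree ≤ d) →
    ∃ g : ℤ[X], (0 < g.natDegree ∧ (∀ s ∈ S, ∃ r : ℤ, aeval s g = (r : ℂ)) ∧
      (∀ z : ℂ, aeval z (derivative g) = 0 → ∃ r : ℤ, aeval z g = (r : ℂ)) ∧
      ∀ b : ℚ, 1 < padicNorm p b → 1 < padicNorm p (aeval b g) ∧ aeval b (derivative g) ≠ 0) := by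
  induction d with
  | zero => exact fun S hint hdeg => ⟨X, goal_base S hint fun s hs => (hdeg s hs).trans zero_le_one⟩
  | succ d ih =>
    intro S hint hdeg
    rcases Nat.eq_zero_or_pos d with rfl | hd
    · exact ⟨X, goal_base S hint (by simpa using hdeg)⟩
    · exact goal_succ hd hdp (ih (by omega)) _ S rfl hint hdeg

/-- **Descent to `ℚ` protecting a `p`-adically large point** ([NCBelyi] Lem. 2.4, `p`-adic form).
For a prime `p` and a finite set `S` of algebraic integers all of degree `< p` over `ℚ`, there is a
non-constant polynomial `g ∈ ℤ[x]` such that `g(S) ⊂ ℤ`, every (finite) critical value of `g` lies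
in `ℤ`, and for every rational `b` with `|b|_p > 1`: `|g(b)|_p > 1` — so `g(b)` is a rational number
outside `ℤ ⊇ g(S) ∪ {critical values}` — and `g'(b) ≠ 0`.
[cite: MochizukiNCBelyi2004, Lem 2.4 pp. 4–5] -/
theorem descent (p : ℕ) [Fact p.Prime] (S : Finset ℂ) (hint : ∀ s ∈ S, IsIntegral ℤ s)
    (hdeg : ∀ s ∈ S, (minpoly ℚ s).natDegree < p) :
    ∃ g : ℤ[X], 0 < g.natDegree ∧ (∀ s ∈ S, ∃ r : ℤ, aeval s g = (r : ℂ)) ∧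
      (∀ z : ℂ, aeval z (derivative g) = 0 → ∃ r : ℤ, aeval z g = (r : ℂ)) ∧
      ∀ b : ℚ, 1 < padicNorm p b → 1 < padicNorm p (aeval b g) ∧ aeval b (derivative g) ≠ 0 := by
  classical
  rcases S.eq_empty_or_nonempty with rfl | hne
  · exact goal_all (p := p) 0 (Fact.out : p.Prime).pos ∅ (by simp) (by simp)
  · set d := S.sup' hne fun s => (minpoly ℚ s).natDegree with hd
    obtain ⟨s₀, hs₀, hds₀⟩ := Finset.exists_mem_eq_sup' hne fun s => (minpoly ℚ s).natDegree
    have hdp : d < p := by rw [hd, hds₀]; exact hdeg s₀ hs₀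
    exact goal_all d hdp S hint fun s hs => Finset.le_sup' (fun s => (minpoly ℚ s).natDegree) hs

end NoncriticalBelyi

end Literature.NumberTheory.DiophantineGeometry
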